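import Literature.Computability.Complexity.Classes
import Literature.Computability.Complexity.Nondeterministic
import Literature.Computability.Complexity.Oracle
import Literature.Computability.Complexity.CircuitClasses
import Literature.Computability.MetaComplexity.MCSP
import Literature.Computability.MetaComplexity.RandReductions
import HarnessLib

-- provenance: harness21/H21/H21/Statements/PNP/MCSPHardness.lean @ 5c8a8e7 (interim HEAD d8f2665); M5 mechanical rewrite
/-!
# P vs NP family: hardness of the Minimum Circuit Size Problem

Family `PNP`, statement **pnp.S33** of the gap inventory (outline `H21/Outlines/CplxMeta.md`, §3,
item `PNPMCSPHardness`; notion `mcsp_language`).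

Informal content.
* Hirahara (FOCS 2022, Thm. 1.2): the partial-function Minimum Circuit Size Problem `MCSP*` is
  NP-hard under randomized polynomial-time many-one reductions.
* Kabanets–Cai (STOC 2000, Thm. 10 as cited by the inventory): if `MCSP ∈ P` then for every
  `k : ℕ` some language `L_k ∈ P^NP` has no circuits of size `O(n ^ k)`.

Sources.
* S. Hirahara, *NP-hardness of learning programs and partial MCSP*, FOCS 2022, Thm. 1.2.
* V. Kabanets, J.-Y. Cai, *Circuit minimization problem*, STOC 2000, Thm. 10.

Design choices.
* `MCSP`, `MCSPStar` are G14's languages (`H21/Prelude/CplxMeta/MCSP.lean`, circuit size over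
  the full binary basis `B2`); `IsRandNPHard` is G14's hardness under *two-sided error*
  randomized polynomial-time many-one reductions (`H21/Prelude/CplxMeta/RandReductions.lean`,
  success probability `≥ 2/3`). In Hirahara's proof the error is one-sided — yes-instances are
  mapped to yes-instances of `MCSP*` with probability `1` (the small circuit is exhibited), and
  no-instances to no-instances with probability `1 - o(1)` (random functions are hard) — which
  is the *opposite* sidedness from G14's `PolyTimeRPReducible` (RP-type, no false positives);
  any reduction correct with probability `≥ 2/3` on every input is a reduction in the two-sided
  sense, so the form stated here is the weaker, textbook one (Arora–Barak 2009, §7.6) and is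
  what the inventory text ("NP-hard under randomized poly-time reductions") asks.
* `P^NP` is G01's `PRelClass NP` (`H21/Prelude/CplxCore/Oracle.lean`) and `SIZE` is G01's size
  class (`H21/Prelude/CplxCore/CircuitClasses.lean`). "`L_k` lacks `n ^ k`-size circuits" is
  read, as in Kabanets–Cai, as "`L_k` has no circuit family of size `O(n ^ k)`", rendered
  arithmetically as `L_k ∉ ⋃ c, SIZE (fun n => c * n ^ k + c)` — the same rendering as Kannan's
  theorem pnp.S16 in `H21/Statements/PNP/StructuralPH.lean`. The literal `SIZE (fun n => n ^ k)`
  of the outline would be vacuous: G01's `SIZE s` bounds the size at *every* length including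
  `n = 0`, where `0 ^ k = 0` for `k ≥ 1`, and no circuit on `Fin 0` inputs has zero gates, so
  `SIZE (fun n => n ^ k) = ∅` and every language would trivially lie outside it. With the O-form
  the case `k = 0` is unconditionally true (by counting) but not vacuous, matching the paper.
* Mathlib has no `MCSP`, circuit-size classes or randomized reductions (searched `MCSP`,
  `SIZE`, `Reducible`); nothing is defined in this file.
-/

namespace Literature.Computability.Complexity

open _root_.Computability Nondeterministic Classes MetaComplexity

/-! ### Target statements -/

/-- **pnp.S33** (first half; Hirahara, *NP-hardness of learning programs and partial MCSP*,
FOCS 2022, Thm. 1.2). The partial-function Minimum Circuit Size Problem `MCSP*` is NP-hard under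
randomized polynomial-time many-one reductions: every `L ∈ NP` admits a probabilistic
polynomial-time map `A` with `Pr_r[(A(x; r) ∈ MCSP* ↔ x ∈ L)] ≥ 2/3` for all `x`
(`IsRandNPHard`, two-sided error). Hirahara's reductions have one-sided error (yes-instances
are always mapped to yes-instances, no-instances to no-instances with probability `1 - o(1)`),
so they are in particular reductions in this two-sided sense. [cite: FOCS2022, Thm. 1.2] -/
def isRandNPHard_MCSPStar : Prop :=
  IsRandNPHard MCSPStar

/- `MCSP*` is NP-*complete* under randomized polynomial-time many-one reductions
(`IsRandComplete NP MCSPStar`, i.e. `MCSPStar ∈ NP ∧ IsRandHard NP MCSPStar`): this corollary —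
membership is G14's `MCSPStar_mem_NP`, PROVED as `MetaComplexity.MCSPStar_mem_NP_holds`
(`MetaComplexity/MCSPStarNPProofs.lean`; "it is easy to see that MCSP ∈ NP", Hirahara 2022, §1.2),
and hardness is the named fact `isRandNPHard_MCSPStar` above (Hirahara 2022, Thm. 1.2, which
states hardness only) — was the interim theorem `isRandComplete_NP_MCSPStar :=
⟨MCSPStar_mem_NP, isRandNPHard_MCSPStar⟩`, demoted to a separate named fact by the M5 import and
merged back into `isRandNPHard_MCSPStar` under D-0026 (the two are equivalent:
`isRandComplete_NP_MCSPStar_iff : IsRandComplete NP MCSPStar ↔ isRandNPHard_MCSPStar`, and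
`isRandComplete_NP_MCSPStar_of_isRandNPHard`, both in `MCSPHardnessFromPCP.lean`; the
completeness from the remaining trust base is `isRandComplete_NP_MCSPStar_of_pcp`,
`MCSPHardnessFromTwoFacts.lean`). No declaration of that name remains. -/

/-- **pnp.S33** (second half; Kabanets–Cai, *Circuit minimization problem*, STOC 2000, Thm. 10
as cited by the inventory). If `MCSP ∈ P` then `P^NP` does not have fixed-polynomial-size
circuits: for every `k : ℕ` there is a language `L_k ∈ P^NP = PRelClass NP` with no circuit
family of size `O(n ^ k)`, i.e. `L_k ∉ ⋃ c, SIZE (fun n => c * n ^ k + c)` (the O-form of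
pnp.S16/Kannan in `StructuralPH.lean`; the literal `SIZE (fun n => n ^ k)` is empty because of
length `0`, see the module docstring). Mathlib-style name:
`exists_mem_PRelClass_NP_not_mem_SIZE_of_MCSP_mem_P` (alias below); the outline's name is kept
as the primary one. [cite: STOC2000, Thm. 10 as cited by the inventory] -/
def kabanets_cai_MCSP_mem_P : Prop :=
  ∀ (h : MCSP ∈ P) (k : ℕ),
    ∃ L ∈ PRelClass NP, L ∉ ⋃ c : ℕ, SIZE (fun n => c * n ^ k + c)

/-- Mathlib-style alias of `kabanets_cai_MCSP_mem_P` (Kabanets–Cai, STOC 2000, Thm. 10):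
`MCSP ∈ P` implies that for every `k` some `L ∈ P^NP` has no `O(n ^ k)`-size circuits. [cite: STOC2000, Thm. 10] -/
def exists_mem_PRelClass_NP_not_mem_SIZE_of_MCSP_mem_P : Prop :=
  ∀ (h : MCSP ∈ P) (k : ℕ),
    ∃ L ∈ PRelClass NP, L ∉ ⋃ c : ℕ, SIZE (fun n => c * n ^ k + c)

/- interim proof relied on results that are now named facts (D-0014); demoted to a fact by the M5 import, proof preserved:
:=
  kabanets_cai_MCSP_mem_P h k
-/

/-- Corollary of `isRandNPHard_MCSPStar` and `BPP`'s closure under randomized reductions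
(`NP_subset_BPP_of_isRandNPHard_of_mem_BPP`): `MCSP* ∈ BPP` implies `NP ⊆ BPP`
(Hirahara 2022, discussion after Thm. 1.2; Arora–Barak 2009, §7.6). [cite: Hirahara2022, discussion after Thm. 1.2] -/
def NP_subset_BPP_of_MCSPStar_mem_BPP : Prop :=
  ∀ (h : MCSPStar ∈ BPP),
    NP ⊆ BPP

/- interim proof relied on results that are now named facts (D-0014); demoted to a fact by the M5 import, proof preserved:
:=
  NP_subset_BPP_of_isRandNPHard_of_mem_BPP isRandNPHard_MCSPStar h
-/

end Literature.Computability.Complexity
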